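import Literature.Analysis.FluidPDE.SmoothLocalEnergy
import HarnessLib

/-!
# Classical solutions of the Navier–Stokes system with a prescribed drift, and their local
# energy identity against a spatial cutoff

Analysis/FluidPDE support file serving the discharge of
`Literature.Analysis.FluidPDE.leray_regularised_wellposed` (Leray 1934, Ch. V §§26–27): the
**separation of energy** for Leray's regularised system (Leray 1934, §27, (5.2)–(5.7);
Ożański–Pooley 2018, Lemma 6.34) is an estimate for classical solutions of

  `∂ₜu + (w·∇)u = νΔu − ∇p`, `div u = 0`, `div w = 0`                                   (∗)

with the drift `w = J_ε u` (Leray 1934, (5.1); Ożański–Pooley 2018, (6.77)); for `w = u` (∗) is the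
unforced Navier–Stokes system, for a given `w` it is the linearised (Oseen-type) system. This file
records (∗) as a predicate in the shape of the tree's `IsClassicalNSSolutionOn`
(`FluidPDE/ClassicalSolution`) and proves the classical **local energy identity** against a
time-independent cutoff `φ ∈ C²_c(E)` (multiply by `φu`, integrate by parts in space, integrate in
time; Leray 1934, §27, derivation of (5.3); Ożański–Pooley 2018, proof of Lemma 6.34, the display
after (6.84); the `w = u` pattern is Caffarelli–Kohn–Nirenberg 1982, §2, (2.5)):

  `∫ φ|u(t)|² − ∫ φ|u(s)|² = ∫ₛᵗ ( ∫ |u|² ⟪w, ∇φ⟫ − 2ν ∫ ⟪Du(∇φ), u⟫ − 2ν ∫ φ|Du|² + 2 ∫ p ⟪u, ∇φ⟫ )`.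

## Contents (all proved, general finite-dimensional inner product space `E`)

* `IsClassicalDriftNSSolutionOn S ν w u p` — classical solutions of (∗) on the time set `S`;
  `isClassicalDriftNSSolutionOn_self_iff` — for `w = u` it is `IsClassicalNSSolutionOn S ν 0 u p`.
* `integral_two_mul_inner_eq_of_drift_momentum` — the slice identity
  `∫ 2φ⟪u, ∂ₜu⟫ = ∫ |u|²⟪w, ∇φ⟫ − 2ν ∫ ⟪Du(∇φ), u⟫ − 2ν ∫ φ|Du|² + 2∫ p⟪u, ∇φ⟫` (from the tree's
  `integral_two_mul_inner_eq_of_momentum` with the fluxes `Nᵢ = uᵢ w`, the transport identity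
  `2∫ φ⟪Du(w), u⟫ = −∫ |u|²⟪w, ∇φ⟫` for `div w = 0`, and Green's identity
  `∫ |u|² Δφ = −2 ∫ ⟪Du(∇φ), u⟫`).
* `integral_mul_norm_sq_sub_eq_integral_Ioo` — time integration of `∫ 2φ⟪u, ∂ₜu⟫` on an open
  time set (`[s, t] ⊆ S`), and
* `IsClassicalDriftNSSolutionOn.local_energy_identity` — the identity displayed above.

## Mathlib / tree search

No drift/Oseen/regularised classical-solution predicate in Mathlib or the tree (searched
`Drift`, `Oseen`, `Regularis`, `structure IsClassical`): the tree has `IsClassicalNSSolutionOn`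
(`w = u`, forced) and the slice identity `integral_two_mul_inner_eq_of_momentum`
(`SmoothLocalEnergy`, mollified fluxes `Nᵢ`), whole-space integration by parts (`WholeSpaceIBP`)
and the space–time calculus of `IsSmoothSpaceTimeOn` (`SpaceTimeCalculus`,
`ClassicalSolutionCalculus`), all reused here.

## References

* J. Leray, *Sur le mouvement d'un liquide visqueux emplissant l'espace*, Acta Math. 63 (1934),
  Ch. V §26, (5.1) (the regularised system) and §27, (5.2)–(5.3).
* W. S. Ożański, B. C. Pooley, *Leray's fundamental work on the Navier–Stokes equations: a modern
  review*, LMS Lecture Note Ser. 452 (CUP 2018) = arXiv:1708.09787, (6.77), Lemma 6.34 and its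
  proof.
* L. Caffarelli, R. Kohn, L. Nirenberg, CPAM 35 (1982), §2, (2.5).
-/

noncomputable section

open MeasureTheory TopologicalSpace Set Function Filter InnerProductSpace
open scoped ENNReal NNReal Laplacian RealInnerProductSpace ContDiff Topology

namespace Literature.Analysis.FluidPDE

/-! ### Classical solutions of the Navier–Stokes system with a prescribed drift -/

section Structure

variable {E : Type*} [NormedAddCommGroup E] [InnerProductSpace ℝ E] [FiniteDimensional ℝ E]

/-- **Classical solutions of the Navier–Stokes system with drift `w`** on `E × S` (`S ⊆ ℝ` a time
set): `u`, `w`, `p` jointly `C^∞` on `S × E`, the momentum equation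
`∂ₜu + (w·∇)u = νΔu − ∇p` pointwise (one-sided time derivative `timeDerivWithin S`, as in
`IsClassicalNSSolutionOn`), and `div u = 0`, `div w = 0` on `S`. For `w = J_ε u` this is Leray's
regularised system (Leray 1934, (5.1): `νΔuᵢ − ∂ₜuᵢ − ∂ᵢp = Σₖ \overline{u_k} ∂ₖuᵢ`, `div u = 0`;
Ożański–Pooley 2018, (6.77)); for `w = u` the unforced Navier–Stokes system
(`isClassicalDriftNSSolutionOn_self_iff`). Initial data are a separate hypothesis in statements. [cite: Leray1934, Ch. V §26 (5.1)] -/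
structure IsClassicalDriftNSSolutionOn (S : Set ℝ) (ν : ℝ) (w u : ℝ → E → E) (p : ℝ → E → ℝ) :
    Prop where
  /-- The velocity is jointly smooth on `S × E`. -/
  smooth_velocity : IsSmoothSpaceTimeOn S u
  /-- The drift is jointly smooth on `S × E`. -/
  smooth_drift : IsSmoothSpaceTimeOn S w
  /-- The pressure is jointly smooth on `S × E`. -/
  smooth_pressure : IsSmoothSpaceTimeOn S p
  /-- The momentum equation `∂ₜu + (w·∇)u = νΔu − ∇p` holds pointwise on `S × E`. -/
  momentum : ∀ t ∈ S, ∀ x,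
    timeDerivWithin S u t x + convect (w t) (u t) x = ν • (Δ (u t)) x - gradient (p t) x
  /-- Incompressibility of the velocity, `div u(t) = 0` for `t ∈ S`. -/
  divFree : ∀ t ∈ S, VectorCalculus.IsDivFree (u t)
  /-- Incompressibility of the drift, `div w(t) = 0` for `t ∈ S`. -/
  divFree_drift : ∀ t ∈ S, VectorCalculus.IsDivFree (w t)

variable {S : Set ℝ} {ν : ℝ} {w u : ℝ → E → E} {p : ℝ → E → ℝ}

/-- For `w = u`, a classical drift solution is exactly a classical solution of the unforced
Navier–Stokes system in the sense of `IsClassicalNSSolutionOn` (force `0`). [folklore] -/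
theorem isClassicalDriftNSSolutionOn_self_iff :
    IsClassicalDriftNSSolutionOn S ν u u p ↔ IsClassicalNSSolutionOn S ν (fun _ _ => 0) u p := by
  constructor
  · intro h
    exact
      { smooth_velocity := h.smooth_velocity
        smooth_pressure := h.smooth_pressure
        momentum := fun t ht x => by rw [h.momentum t ht x, add_zero]
        divFree := h.divFree }
  · intro h
    exact
      { smooth_velocity := h.smooth_velocity
        smooth_drift := h.smooth_velocity
        smooth_pressure := h.smooth_pressure
        momentum := fun t ht x => by rw [h.momentum t ht x, add_zero]
        divFree := h.divFree
        divFree_drift := h.divFree }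

/-- Restriction of the time set (to a subset of unique differentiability, e.g. an open subset or
a nontrivial interval), cf. `IsClassicalNSSolutionOn.mono`. [folklore] -/
theorem IsClassicalDriftNSSolutionOn.mono {S' : Set ℝ} (h : IsClassicalDriftNSSolutionOn S ν w u p)
    (hS' : S' ⊆ S) (hU : UniqueDiffOn ℝ S') : IsClassicalDriftNSSolutionOn S' ν w u p where
  smooth_velocity := h.smooth_velocity.mono hS'
  smooth_drift := h.smooth_drift.mono hS'
  smooth_pressure := h.smooth_pressure.mono hS'
  momentum t ht x := by
    rw [h.smooth_velocity.timeDerivWithin_eq_of_subset hS' hU ht x]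
    exact h.momentum t (hS' ht) x
  divFree t ht := h.divFree t (hS' ht)
  divFree_drift t ht := h.divFree_drift t (hS' ht)

/-- On an open time set the one-sided time derivative in the momentum equation is the two-sided
`timeDeriv`: `∂ₜu + (w·∇)u = νΔu − ∇p` with `timeDeriv`. [folklore] -/
theorem IsClassicalDriftNSSolutionOn.momentum_timeDeriv (h : IsClassicalDriftNSSolutionOn S ν w u p)
    (hS : IsOpen S) {t : ℝ} (ht : t ∈ S) (x : E) :
    timeDeriv u t x + convect (w t) (u t) x = ν • (Δ (u t)) x - gradient (p t) x := by
  rw [timeDeriv_apply, ← timeDerivWithin_eq_deriv hS ht u x]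
  exact h.momentum t ht x

end Structure

/-! ### The slice identity -/

section Slice

variable {E : Type*} [NormedAddCommGroup E] [InnerProductSpace ℝ E] [FiniteDimensional ℝ E]
  [MeasurableSpace E] [BorelSpace E]
variable {ι : Type*} [Fintype ι]

/-- **Transport identity with a divergence-free drift** (slice form of
`∫ (w·∇)u · φu = −½ ∫ |u|² w·∇φ`): for `V, w ∈ C¹(E; E)` with `div w = 0` on `{φ ≠ 0}` and
`φ ∈ C¹_c`, `2 ∫ φ ⟪DV(w), V⟫ = −∫ |V|² ⟪w, ∇φ⟫` (Leray 1934, §27, the term `∂ₖf \overline{u_k}|u|²`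
of (5.3); Ożański–Pooley 2018, proof of Lemma 6.34). [cite: Leray1934, Ch. V §27 (5.3)] -/
theorem two_mul_integral_mul_inner_fderiv_drift {V w : E → E} {φ : E → ℝ} (hV : ContDiff ℝ 1 V)
    (hw : ContDiff ℝ 1 w) (hφ : ContDiff ℝ 1 φ) (hφc : HasCompactSupport φ)
    (hdivw : ∀ x, φ x ≠ 0 → VectorCalculus.divergence w x = 0) :
    2 * ∫ x, φ x * ⟪fderiv ℝ V x (w x), V x⟫ = -∫ x, ‖V x‖ ^ 2 * ⟪w x, gradient φ x⟫ := by
  have hdV : ∀ x, DifferentiableAt ℝ V x := fun x => hV.differentiable one_ne_zero x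
  have hdw : ∀ x, DifferentiableAt ℝ w x := fun x => hw.differentiable one_ne_zero x
  have hdφ : ∀ x, DifferentiableAt ℝ φ x := fun x => hφ.differentiable one_ne_zero x
  have hu : ContDiff ℝ 1 fun x => φ x • w x := hφ.smul hw
  have huc : HasCompactSupport fun x => φ x • w x := hφc.smul_right
  -- `∫ |V|² div(φw) + ∫ ⟪φw, ∇|V|²⟫ = 0`
  have h := integral_mul_divergence_add_eq_zero_right (hV.norm_sq ℝ) hu huc
  have hl : ∀ x, ‖V x‖ ^ 2 * VectorCalculus.divergence (fun y => φ y • w y) x =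
      ‖V x‖ ^ 2 * ⟪w x, gradient φ x⟫ := fun x => by
    rw [divergence_smul_apply (hdφ x) (hdw x)]
    by_cases hx : φ x = 0
    · simp [hx]
    · rw [hdivw x hx, mul_zero, zero_add]
  have hr : ∀ x, ⟪φ x • w x, gradient (fun y => ‖V y‖ ^ 2) x⟫ =
      2 * (φ x * ⟪fderiv ℝ V x (w x), V x⟫) := fun x => by
    rw [inner_gradient_right_eq_fderiv, fderiv_norm_sq_comp_apply (hdV x), map_smul,
      real_inner_smul_right, real_inner_comm]
  rw [integral_congr_ae (Eventually.of_forall hl), integral_congr_ae (Eventually.of_forall hr),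
    integral_const_mul] at h
  linarith

/-- **Green's identity for `|V|²` against a cutoff**: for `V ∈ C²` and `φ ∈ C²_c`,
`∫ |V|² Δφ = −2 ∫ ⟪DV(∇φ), V⟫` (`∫ f Δφ = −∫ ⟪∇f, ∇φ⟫` with `∇|V|² · h = 2⟪V, DV h⟫`; the step
from Leray's `Δf`-form to the `∂ₖf uᵢ ∂ₖuᵢ`-form of (5.3)). [folklore] -/
theorem integral_norm_sq_mul_laplacian_eq (b : OrthonormalBasis ι ℝ E) {V : E → E} {φ : E → ℝ}
    (hV : ContDiff ℝ 2 V) (hφ : ContDiff ℝ 2 φ) (hφc : HasCompactSupport φ) :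
    ∫ x, ‖V x‖ ^ 2 * (Δ φ) x = -2 * ∫ x, ⟪fderiv ℝ V x (gradient φ x), V x⟫ := by
  have hV1 : ContDiff ℝ 1 V := hV.of_le one_le_two
  have hdV : ∀ x, DifferentiableAt ℝ V x := fun x => hV1.differentiable one_ne_zero x
  have hsq : ContDiff ℝ 1 fun x => ‖V x‖ ^ 2 := hV1.norm_sq ℝ
  -- Green: `∫ ⟪Δφ, |V|²⟫ + Σᵢ ∫ ⟪Dφ bᵢ, D|V|² bᵢ⟫ = 0`
  have h := integral_inner_laplacian_add_eq_zero b (F' := ℝ) hφ hsq (Or.inl hφc)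
  have h1 : ∀ x, ⟪(Δ φ) x, ‖V x‖ ^ 2⟫ = ‖V x‖ ^ 2 * (Δ φ) x := fun x => by
    simp
  -- the sum of the coordinate terms is `2 ⟪DV(∇φ), V⟫`
  have hterm : ∀ i x, ⟪fderiv ℝ φ x (b i), fderiv ℝ (fun y => ‖V y‖ ^ 2) x (b i)⟫ =
      2 * (fderiv ℝ φ x (b i) * ⟪V x, fderiv ℝ V x (b i)⟫) := fun i x => by
    rw [fderiv_norm_sq_comp_apply (hdV x)]
    simp
    ring
  have hint : ∀ i, Integrable (fun x => ⟪fderiv ℝ φ x (b i), fderiv ℝ (fun y => ‖V y‖ ^ 2) x (b i)⟫)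
      (volume : Measure E) := by
    intro i
    refine integrable_of_continuous_of_tsupport ?_ hφc fun x hx => ?_
    · exact ((hφ.continuous_fderiv (by simp)).clm_apply continuous_const).inner
        ((hsq.continuous_fderiv one_ne_zero).clm_apply continuous_const)
    · rw [fderiv_of_notMem_tsupport ℝ hx]
      simp
  have hsum : ∑ i, ∫ x, ⟪fderiv ℝ φ x (b i), fderiv ℝ (fun y => ‖V y‖ ^ 2) x (b i)⟫ =
      2 * ∫ x, ⟪fderiv ℝ V x (gradient φ x), V x⟫ := by
    rw [← integral_finsetSum _ fun i _ => hint i, ← integral_const_mul]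
    refine integral_congr_ae (Eventually.of_forall fun x => ?_)
    simp only [hterm, ← Finset.mul_sum]
    congr 1
    -- `Σᵢ Dφ(bᵢ) ⟪V, DV bᵢ⟫ = ⟪DV(∇φ), V⟫` with `∇φ = Σᵢ ⟪bᵢ, ∇φ⟫ bᵢ`
    conv_rhs => rw [← b.sum_repr' (gradient φ x)]
    rw [map_sum, sum_inner]
    refine Finset.sum_congr rfl fun i _ => ?_
    rw [map_smul, real_inner_smul_left, inner_gradient_right_eq_fderiv, real_inner_comm]
  rw [integral_congr_ae (Eventually.of_forall h1), hsum] at h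
  linarith

/-- **The slice identity behind the separation of energy.** Let `b` be an orthonormal basis of
`E`, `V ∈ C²(E; E)`, `w ∈ C¹(E; E)`, `P ∈ C¹(E; ℝ)`, `φ ∈ C²_c(E; ℝ)`, and assume that on
`{φ ≠ 0}` the fields satisfy `W + (w·∇)V = νΔV − ∇P`, `div V = 0`, `div w = 0` (think `W = ∂ₜu(t)`,
`V = u(t)`, `w = J_ε u(t)`). Then
`∫ 2φ⟪V, W⟫ = ∫ |V|²⟪w, ∇φ⟫ − 2ν ∫ ⟪DV(∇φ), V⟫ − 2ν ∫ φ|DV|² + 2 ∫ P⟪V, ∇φ⟫`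
— the scalar product of the regularised equations with `φ V`, integrated by parts in space
(Leray 1934, §27, (5.3); Ożański–Pooley 2018, proof of Lemma 6.34, first display). [cite: Leray1934, Ch. V §27 (5.3)] -/
theorem integral_two_mul_inner_eq_of_drift_momentum (b : OrthonormalBasis ι ℝ E) {ν : ℝ}
    {V W w : E → E} {P φ : E → ℝ}
    (hV : ContDiff ℝ 2 V) (hw : ContDiff ℝ 1 w) (hP : ContDiff ℝ 1 P)
    (hφ : ContDiff ℝ 2 φ) (hφc : HasCompactSupport φ)
    (hmom : ∀ x, φ x ≠ 0 → W x + convect w V x = ν • (Δ V) x - gradient P x)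
    (hdiv : ∀ x, φ x ≠ 0 → VectorCalculus.divergence V x = 0)
    (hdivw : ∀ x, φ x ≠ 0 → VectorCalculus.divergence w x = 0) :
    ∫ x, 2 * φ x * ⟪V x, W x⟫ =
      (∫ x, ‖V x‖ ^ 2 * ⟪w x, gradient φ x⟫) -
        2 * ν * (∫ x, ⟪fderiv ℝ V x (gradient φ x), V x⟫) -
        2 * ν * (∫ x, φ x * frobeniusNormSq (fderiv ℝ V x)) +
        2 * ∫ x, P x * ⟪V x, gradient φ x⟫ := by
  have hV1 : ContDiff ℝ 1 V := hV.of_le one_le_two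
  have hφ1 : ContDiff ℝ 1 φ := hφ.of_le one_le_two
  have hdV : ∀ x, DifferentiableAt ℝ V x := fun x => hV1.differentiable one_ne_zero x
  have hdw : ∀ x, DifferentiableAt ℝ w x := fun x => hw.differentiable one_ne_zero x
  -- the fluxes `Nᵢ = Vᵢ w`
  set N : ι → E → E := fun i x => ⟪V x, b i⟫ • w x with hN
  have hVi : ∀ i, ContDiff ℝ 1 fun x => ⟪V x, b i⟫ := fun i => hV1.inner ℝ contDiff_const
  have hdVi : ∀ i x, DifferentiableAt ℝ (fun y => ⟪V y, b i⟫) x := fun i x =>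
    (hVi i).differentiable one_ne_zero x
  have hNd : ∀ i, ContDiff ℝ 1 (N i) := fun i => (hVi i).smul hw
  have hfi : ∀ i x, fderiv ℝ (fun y => ⟪V y, b i⟫) x (w x) = ⟪fderiv ℝ V x (w x), b i⟫ := by
    intro i x
    rw [fderiv_inner_apply ℝ (hdV x) (differentiableAt_const _)]
    simp
  -- divergence of the fluxes: `div Nᵢ = ⟪DV(w), bᵢ⟫` where `div w = 0`
  have hdivN : ∀ x, φ x ≠ 0 → ∀ i,
      VectorCalculus.divergence (N i) x = ⟪convect w V x, b i⟫ := by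
    intro x hx i
    rw [hN, divergence_smul_apply (hdVi i x) (hdw x), hdivw x hx, mul_zero, zero_add,
      inner_gradient_right_eq_fderiv, hfi, convect_apply]
  -- the momentum equation in components
  have hmom' : ∀ x, φ x ≠ 0 → ∀ i, ⟪W x, b i⟫ + VectorCalculus.divergence (N i) x -
      ν * ⟪(Δ V) x, b i⟫ + fderiv ℝ P x (b i) = 0 := by
    intro x hx i
    have h := congrArg (fun v => ⟪v, b i⟫) (hmom x hx)
    simp only [inner_add_left, inner_sub_left, inner_smul_left, RCLike.conj_to_real] at h
    rw [hdivN x hx i, ← inner_gradient_right_eq_fderiv, real_inner_comm (gradient P x) (b i)]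
    linarith
  have hmain := integral_two_mul_inner_eq_of_momentum b (ν := ν) (W := W) hV hNd hP hφ hφc hmom' hdiv
  -- the flux terms: pointwise `Σᵢ (⟪Nᵢ, ∇φ⟫ Vᵢ + φ ⟪DV(Nᵢ), bᵢ⟫) = |V|²⟪w, ∇φ⟫ + φ ⟪DV(w), V⟫`
  have hpt : ∀ x, ∑ i, (⟪N i x, gradient φ x⟫ * ⟪V x, b i⟫ + φ x * ⟪fderiv ℝ V x (N i x), b i⟫) =
      ‖V x‖ ^ 2 * ⟪w x, gradient φ x⟫ + φ x * ⟪fderiv ℝ V x (w x), V x⟫ := by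
    intro x
    simp only [hN, map_smul, real_inner_smul_left, Finset.sum_add_distrib]
    have e1 : ∑ i, ⟪V x, b i⟫ * ⟪w x, gradient φ x⟫ * ⟪V x, b i⟫ =
        ‖V x‖ ^ 2 * ⟪w x, gradient φ x⟫ := by
      have := b.sum_inner_mul_inner (V x) (V x)
      rw [real_inner_self_eq_norm_sq] at this
      rw [← this, Finset.sum_mul]
      refine Finset.sum_congr rfl fun i _ => ?_
      rw [real_inner_comm (b i) (V x)]
      ring
    have e2 : ∑ i, φ x * (⟪V x, b i⟫ * ⟪fderiv ℝ V x (w x), b i⟫) =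
        φ x * ⟪fderiv ℝ V x (w x), V x⟫ := by
      rw [← Finset.mul_sum]
      congr 1
      have := b.sum_inner_mul_inner (V x) (fderiv ℝ V x (w x))
      rw [real_inner_comm] at this
      rw [← this]
      refine Finset.sum_congr rfl fun i _ => ?_
      rw [real_inner_comm (b i) (fderiv ℝ V x (w x))]
    rw [e1, e2]
  have hint : ∀ i, Integrable (fun x => ⟪N i x, gradient φ x⟫ * ⟪V x, b i⟫ +
      φ x * ⟪fderiv ℝ V x (N i x), b i⟫) (volume : Measure E) := by
    intro i
    refine integrable_of_continuous_of_tsupport ?_ hφc fun x hx => ?_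
    · refine (((hNd i).continuous.inner (continuous_gradient_of_contDiff hφ1)).mul
        (hV.continuous.inner continuous_const)).add (hφ.continuous.mul ?_)
      exact (isBoundedBilinearMap_apply.continuous.comp
        ((hV1.continuous_fderiv one_ne_zero).prodMk (hNd i).continuous)).inner continuous_const
    · simp [gradient_eq_zero_of_notMem_tsupport hx, image_eq_zero_of_notMem_tsupport hx]
  have hflux : ∑ i, ∫ x, (⟪N i x, gradient φ x⟫ * ⟪V x, b i⟫ +
      φ x * ⟪fderiv ℝ V x (N i x), b i⟫) =
      (∫ x, ‖V x‖ ^ 2 * ⟪w x, gradient φ x⟫) + ∫ x, φ x * ⟪fderiv ℝ V x (w x), V x⟫ := by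
    rw [← integral_finsetSum _ fun i _ => hint i, integral_congr_ae (Eventually.of_forall hpt)]
    refine integral_add ?_ ?_
    · refine integrable_of_continuous_of_tsupport ?_ hφc fun x hx => ?_
      · exact (hV.continuous.norm.pow 2).mul (hw.continuous.inner (continuous_gradient_of_contDiff hφ1))
      · simp [gradient_eq_zero_of_notMem_tsupport hx]
    · refine integrable_of_continuous_of_tsupport ?_ hφc fun x hx => ?_
      · exact hφ.continuous.mul ((isBoundedBilinearMap_apply.continuous.comp
          ((hV1.continuous_fderiv one_ne_zero).prodMk hw.continuous)).inner hV.continuous)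
      · simp [image_eq_zero_of_notMem_tsupport hx]
  have htr := two_mul_integral_mul_inner_fderiv_drift hV1 hw hφ1 hφc hdivw
  have hgr := integral_norm_sq_mul_laplacian_eq b hV hφ hφc
  rw [hmain, hflux, hgr]
  linarith

end Slice

/-! ### Time integration and the local energy identity -/

section SpaceTime

variable {E : Type*} [NormedAddCommGroup E] [InnerProductSpace ℝ E] [FiniteDimensional ℝ E]
  [MeasurableSpace E] [BorelSpace E]

/-- **Time integration of `∫ 2φ ⟪u, ∂ₜu⟫` on an open time set.** For `u` jointly smooth on
`S × E`, `S` open, `[s, t] ⊆ S`, and a continuous compactly supported weight `φ`: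
`∫ φ|u(t)|² − ∫ φ|u(s)|² = ∫ₛᵗ ∫ 2φ ⟪u, ∂ₜu⟫` (Fubini over the compact support and the fundamental
theorem of calculus on time lines; the pattern of Leray 1934, §17, (3.1) ⇒ (3.4)). [folklore] -/
theorem integral_mul_norm_sq_sub_eq_integral_Ioo {S : Set ℝ} {u : ℝ → E → E}
    (hu : IsSmoothSpaceTimeOn S u) (hS : IsOpen S) {φ : E → ℝ} (hφ : Continuous φ)
    (hc : HasCompactSupport φ) {s t : ℝ} (hst : s ≤ t) (hI : Icc s t ⊆ S) :
    (∫ x, φ x * ‖u t x‖ ^ 2) - (∫ x, φ x * ‖u s x‖ ^ 2) =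
      ∫ τ in Ioo s t, ∫ x, 2 * φ x * ⟪u τ x, timeDeriv u τ x⟫ := by
  have hu_cont : ContinuousOn (uncurry u) (S ×ˢ univ) := hu.continuousOn
  have hdt : IsSmoothSpaceTimeOn S (timeDeriv u) := by
    have h := hu.timeDerivWithin hS.uniqueDiffOn
    refine h.congr fun z hz => ?_
    obtain ⟨τ, x⟩ := z
    simp only [uncurry_apply_pair, timeDeriv_apply]
    exact (timeDerivWithin_eq_deriv hS hz.1 u x).symm
  have hdt_cont : ContinuousOn (uncurry (timeDeriv u)) (S ×ˢ univ) := hdt.continuousOn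
  have hsub : Icc s t ×ˢ (univ : Set E) ⊆ S ×ˢ univ := prod_mono hI Subset.rfl
  have hKφ : ∀ x ∉ tsupport φ, φ x = 0 := fun x hx => image_eq_zero_of_notMem_tsupport hx
  set D : ℝ × E → ℝ := fun z => 2 * φ z.2 * ⟪u z.1 z.2, timeDeriv u z.1 z.2⟫ with hD
  have hDcont : ContinuousOn D (Icc s t ×ˢ univ) :=
    (continuousOn_const.mul (hφ.comp continuous_snd).continuousOn).mul
      ((hu_cont.mono hsub).inner (hdt_cont.mono hsub))
  have hDK : ∀ τ ∈ Icc s t, ∀ x ∉ tsupport φ, D (τ, x) = 0 := fun τ _ x hx => by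
    simp [hD, hKφ x hx]
  have hDint := integrable_prod_of_continuousOn hc hDcont hDK
  have hswap := integral_integral_swap (f := fun τ x => D (τ, x)) hDint
  simp only [hD] at hswap
  rw [hswap]
  have hslice : ∀ {r : ℝ}, r ∈ S →
      Integrable (fun x => φ x * ‖u r x‖ ^ 2) (volume : Measure E) := fun hr =>
    (hφ.mul ((hu.contDiff_slice hr).continuous.norm.pow 2)).integrable_of_hasCompactSupport
      hc.mul_right
  have htI : t ∈ S := hI (right_mem_Icc.2 hst)
  have hsI : s ∈ S := hI (left_mem_Icc.2 hst)
  have hline : ∀ x, ∫ τ in Ioo s t, 2 * φ x * ⟪u τ x, timeDeriv u τ x⟫ =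
      φ x * ‖u t x‖ ^ 2 - φ x * ‖u s x‖ ^ 2 := by
    intro x
    rcases eq_or_lt_of_le hst with rfl | hst'
    · simp
    have hcont : ContinuousOn (fun τ => φ x * ‖u τ x‖ ^ 2) (Icc s t) := by
      refine continuousOn_const.mul (ContinuousOn.pow ?_ 2)
      exact (hu_cont.comp (Continuous.prodMk_left x).continuousOn
        fun τ hτ => mk_mem_prod (hI hτ) (mem_univ x)).norm
    have hderiv : ∀ τ ∈ Ioo s t, HasDerivWithinAt (fun τ => φ x * ‖u τ x‖ ^ 2)
        (2 * φ x * ⟪u τ x, timeDeriv u τ x⟫) (Ioi τ) τ := by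
      intro τ hτ
      have hτS : τ ∈ S := hI (Ioo_subset_Icc_self hτ)
      have hu' : HasDerivAt (fun σ => u σ x) (timeDeriv u τ x) τ := by
        rw [timeDeriv_apply]
        exact hu.hasDerivAt_timeLine hS hτS x
      have h2 := ((hu'.inner ℝ hu').const_mul (φ x)).hasDerivWithinAt (s := Ioi τ)
      have hfun : (fun σ => φ x * ⟪u σ x, u σ x⟫) = fun σ => φ x * ‖u σ x‖ ^ 2 := by
        funext σ
        rw [real_inner_self_eq_norm_sq]
      rw [hfun] at h2
      refine h2.congr_deriv ?_
      rw [real_inner_comm]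
      ring
    have hint : IntervalIntegrable (fun τ => 2 * φ x * ⟪u τ x, timeDeriv u τ x⟫) volume s t := by
      refine ContinuousOn.intervalIntegrable ?_
      rw [uIcc_of_le hst]
      exact hDcont.comp (Continuous.prodMk_left x).continuousOn
        fun τ hτ => mk_mem_prod hτ (mem_univ x)
    have := intervalIntegral.integral_eq_sub_of_hasDeriv_right_of_le hst hcont hderiv hint
    rw [intervalIntegral.integral_of_le hst, integral_Ioc_eq_integral_Ioo] at this
    rw [this]
  rw [integral_congr_ae (Eventually.of_forall hline), integral_sub (hslice htI) (hslice hsI)]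

variable {ι : Type*} [Fintype ι]

/-- **The local energy identity for classical drift solutions** (space–time form, spatial
cutoff). Let `(w, u, p)` be a classical solution of `∂ₜu + (w·∇)u = νΔu − ∇p`, `div u = div w = 0`
on an open time set `S ⊇ [s, t]`, and `φ ∈ C²_c(E)`. Then
`∫ φ|u(t)|² − ∫ φ|u(s)|² = ∫ₛᵗ ( ∫ |u|²⟪w, ∇φ⟫ − 2ν ∫ ⟪Du(∇φ), u⟫ − 2ν ∫ φ|Du|² + 2 ∫ p⟪u, ∇φ⟫ ) dτ`
(Leray 1934, §27, (5.3) integrated in time; Ożański–Pooley 2018, proof of Lemma 6.34, the identity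
"`2∫∫ f|∇u|² + ∫ f|u|² = ∫ f|u₀|² − ∫∫(2∂ₖf uᵢ∂ₖuᵢ + 2∂ᵢf p uᵢ + ∂ₖf (J_εu)ₖ|u|²)`", here with
the sign convention `φ` in place of `f` and general `s`). [cite: OzanskiPooley2018, Lemma 6.34 (proof)] -/
theorem IsClassicalDriftNSSolutionOn.local_energy_identity (b : OrthonormalBasis ι ℝ E) {S : Set ℝ}
    {ν : ℝ} {w u : ℝ → E → E} {p : ℝ → E → ℝ} (h : IsClassicalDriftNSSolutionOn S ν w u p)
    (hS : IsOpen S) {φ : E → ℝ} (hφ : ContDiff ℝ 2 φ) (hφc : HasCompactSupport φ) {s t : ℝ}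
    (hst : s ≤ t) (hI : Icc s t ⊆ S) :
    (∫ x, φ x * ‖u t x‖ ^ 2) - (∫ x, φ x * ‖u s x‖ ^ 2) =
      ∫ τ in Ioo s t, ((∫ x, ‖u τ x‖ ^ 2 * ⟪w τ x, gradient φ x⟫) -
        2 * ν * (∫ x, ⟪fderiv ℝ (u τ) x (gradient φ x), u τ x⟫) -
        2 * ν * (∫ x, φ x * frobeniusNormSq (fderiv ℝ (u τ) x)) +
        2 * ∫ x, p τ x * ⟪u τ x, gradient φ x⟫) := by
  rw [integral_mul_norm_sq_sub_eq_integral_Ioo h.smooth_velocity hS hφ.continuous hφc hst hI]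
  refine setIntegral_congr_fun measurableSet_Ioo fun τ hτ => ?_
  have hτS : τ ∈ S := hI (Ioo_subset_Icc_self hτ)
  exact integral_two_mul_inner_eq_of_drift_momentum b
    ((h.smooth_velocity.contDiff_slice hτS).of_le (by norm_cast))
    ((h.smooth_drift.contDiff_slice hτS).of_le (by norm_cast))
    ((h.smooth_pressure.contDiff_slice hτS).of_le (by norm_cast)) hφ hφc
    (fun x _ => h.momentum_timeDeriv hS hτS x) (fun x _ => h.divFree τ hτS x)
    (fun x _ => h.divFree_drift τ hτS x)

end SpaceTime

end Literature.Analysis.FluidPDE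

end
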